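import Summits.ResolutionOfSingularities.ResolutionOfSingularities.Theorems.HilbertSamuelEliminationSigmaMaxModificationsCorridor3CPFramePropagationMenuChain
import Literature.AlgebraicGeometry.Resolution.BlowupOffCentre
import Literature.AlgebraicGeometry.Resolution.MonomialOrderReductionUnit
import HarnessLib

/-!
# [OURS · L1 W4.2] D18 WAITING STEPS: an E-adapted CP frame passes UNCHANGED through a canonical step whose centre misses the marked point,
# and the E-adapted chain with the face-reading binder asked ONLY at steps THROUGH the marked point
# (cell res-hironaka, LADDER-RESOLUTION rung L; slot W4.2, crux chain w42 `SigmaMaxModificationsCorridor3` stmt-ResolutionOfSingularities-19249;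
# `--supports stmt-ResolutionOfSingularities-19249 --as helper`; hand res-D-brk-3 (gen 7), file F3f — REPAIR of the binder shape of
# `exists_isCPFrame_adapted_of_reachesσE` (p561150): there `hread` is asked at EVERY canonical step, but at a WAITING step (`x_n ∉ V(C)`,
# tree `CanonicalNearStep.cases`) `𝓘_{C,x_n} = ⊤` reads as no face, so that binder is dischargeable only on runs without waiting steps)

SCHEME-SIDE BOOKKEEPING (universe `0`), 0 `def`s, every declaration PROVED; OURS; NOT a statement of Hironaka's manuscript [Hironaka2017] nor of
[CossartJannsenSaito2020]/[CossartPiltant2019]. AI-written, weaker than expert review.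

* **`IsCPFrame.exists_isCPFrame_blowup_waiting`** — at a WAITING step (`π(x') = x_n ∉ V(C)`) the blow-down is a local isomorphism at `x'`
  (tree `IsBlowup.isIso_stalkMap_of_not_mem_support`), so `φ' := φ ∘ (π♯_{x'})⁻¹` is a CP frame of the new marked stage with the SAME `(R, u, h)`;
  the exceptional divisor misses `x'` (`IsBlowup.stalkIdeal_comap_centre_eq_top`) and every strict transform reads as before
  (`IsBlowup.stalkIdeal_strictTransformIdeal_of_not_mem`).
* **`isPermissibleAt_of_isCanonicalStep_of_mem`** — a canonical centre THROUGH the marked point of a stage reached from a maximal origin is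
  permissible there (tree `IsMaximalOrigin.centre_package`; the regular value is excluded by `IsMaximalOrigin.not_isBlownUp_of_eq_iterPSum`).
* **`exists_isCPFrame_adapted_of_reachesσE_through`** — the E-adapted chain of p561150 with `hread` asked only when `x_n ∈ V(C)`: genuine steps by
  `IsCPFrame.exists_isCPFrame_blowup_adapted`, waiting steps by the lemma above (reading `e' := e` on transforms).

References: CP 2019 Def. 2.6–2.7, Prop. 2.7 [CossartPiltant2019]; CJS LNM 2270 Def. 3.1, Rem. 6.29 (1) [CossartJannsenSaito2020]; GW (13.19), Prop. 13.91 (3)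
[GortzWedhorn2020].
-/

noncomputable section

set_option linter.dupNamespace false

open CategoryTheory AlgebraicGeometry TopologicalSpace IsLocalRing Polynomial
open Literature.AlgebraicGeometry.Resolution Literature.RingTheory.HilbertSamuel
open Summit.ResolutionOfSingularities.ResolutionOfSingularities.Theorems.CampaignW42
open Summit.ResolutionOfSingularities.ResolutionOfSingularities.Theorems.SigmaMaxModificationsCorridor3.Sigma
open Summit.ResolutionOfSingularities.ResolutionOfSingularities.Theorems.SigmaMaxModificationsCorridor3.Helpers

namespace Summit.ResolutionOfSingularities.ResolutionOfSingularities.Theorems.SigmaMaxModificationsCorridor3.Moving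

/-- [OURS · L1 W4.2] **A CP frame passes unchanged through a WAITING step.** See the module docstring.
[cite: GortzWedhorn2020, Prop. 13.91 (3), (13.19) p. 414] [cite: CossartPiltant2019, Def. 2.6–2.7] -/
theorem IsCPFrame.exists_isCPFrame_blowup_waiting (ν : ℕ → ℕ) {s : MarkedStage.{0}}
    (C : s.W.IdealSheafData) (P' : Option (Pending (blowup C))) (hln' : IsLocallyNoetherian (blowup C)) (x' : ↥(blowup C))
    (hx' : (blowup.π C).base x' = s.pt) (hnot : s.pt ∉ (C.support : Set s.W))
    {R : Type} [CommRing R] {u : Fin 3 → R} {h : R[X]}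
    {φ : (s.W.presheaf.stalk s.pt : Type) →+* R[X] ⧸ Ideal.span {h}} (hF : IsCPFrame s R u h φ) :
    ∃ φ' : ((blowup C).presheaf.stalk x' : Type) →+* R[X] ⧸ Ideal.span {h},
      IsCPFrame ⟨blowup C, hln', s.L.next (Scheme.hsStratum s.W 3 ν) C, P', x'⟩ R u h φ' ∧
      (∀ a, φ' (((blowup.π C).stalkMap x').hom a) = φ ((s.W.presheaf.stalkCongr (Inseparable.of_eq hx')).hom.hom a)) ∧
      stalkIdeal (C.comap (blowup.π C)) x' = ⊤ ∧
      ∀ K : s.W.IdealSheafData,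
        (stalkIdeal (strictTransformIdeal (blowup.π C) C K) x').map φ' = (stalkIdeal K s.pt).map φ := by
  haveI : IsLocallyNoetherian s.W := s.ln
  haveI : IsLocallyNoetherian (blowup C) := hln'
  have hnot' : (blowup.π C).base x' ∉ (C.support : Set s.W) := by rw [hx']; exact hnot
  haveI : IsIso ((blowup.π C).stalkMap x') := (blowup.isBlowup C).isIso_stalkMap_of_not_mem_support hnot'
  -- the stalk transport `ε : 𝒪_{x'} ≃ 𝒪_{π x'} ≃ 𝒪_{x_n}`
  obtain ⟨e₁, he₁⟩ : ∃ e₁ : (s.W.presheaf.stalk ((blowup.π C).base x') : Type) ≃+* ((blowup C).presheaf.stalk x' : Type),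
      (e₁ : _ →+* _) = ((blowup.π C).stalkMap x').hom :=
    ⟨(asIso ((blowup.π C).stalkMap x')).commRingCatIsoToRingEquiv, rfl⟩
  obtain ⟨e₂, he₂⟩ : ∃ e₂ : (s.W.presheaf.stalk ((blowup.π C).base x') : Type) ≃+* (s.W.presheaf.stalk s.pt : Type),
      (e₂ : _ →+* _) = (s.W.presheaf.stalkCongr (Inseparable.of_eq hx')).hom.hom :=
    ⟨(s.W.presheaf.stalkCongr (Inseparable.of_eq hx')).commRingCatIsoToRingEquiv, rfl⟩
  have hcomp : ((φ.comp ((e₁.symm.trans e₂ : _ ≃+* _) : _ →+* _)).comp ((blowup.π C).stalkMap x').hom) =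
      φ.comp (s.W.presheaf.stalkCongr (Inseparable.of_eq hx')).hom.hom := by
    rw [← he₁, ← he₂]
    ext a
    show φ ((e₁.symm.trans e₂) (e₁ a)) = φ (e₂ a)
    rw [RingEquiv.trans_apply, RingEquiv.symm_apply_apply]
  refine ⟨φ.comp ((e₁.symm.trans e₂ : _ ≃+* _) : _ →+* _), ?_, fun a => ?_,
    (blowup.isBlowup C).stalkIdeal_comap_centre_eq_top hnot', fun K => ?_⟩
  · obtain ⟨hR, hloc, hdim, hu, hmon, hφl, hflat, hmap, hsurj, hmin⟩ := hF
    haveI := hloc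
    haveI := hφl
    haveI : IsLocalHom ((e₁.symm.trans e₂ : _ ≃+* _) : ((blowup C).presheaf.stalk x' : Type) →+* (s.W.presheaf.stalk s.pt : Type)) :=
      IsLocalHom.of_surjective _ (e₁.symm.trans e₂).surjective
    refine ⟨hR, hloc, hdim, hu, hmon, RingHom.isLocalHom_comp _ _, RingHom.Flat.comp (.of_bijective (e₁.symm.trans e₂).bijective) hflat,
      ?_, ?_, hmin⟩
    · show Ideal.map (φ.comp _) (maximalIdeal _) = maximalIdeal _
      rw [← Ideal.map_map, IsLocalRing.map_maximalIdeal_of_surjective _ (e₁.symm.trans e₂).surjective]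
      exact hmap
    · show Function.Surjective ((IsLocalRing.residue _).comp (φ.comp _))
      rw [← RingHom.comp_assoc]
      exact hsurj.comp (e₁.symm.trans e₂).surjective
  · exact congrArg (fun f : (s.W.presheaf.stalk ((blowup.π C).base x') : Type) →+* R[X] ⧸ Ideal.span {h} => f a) hcomp
  · rw [(blowup.isBlowup C).stalkIdeal_strictTransformIdeal_of_not_mem K hnot', stalkIdeal_comap_eq_map_stalkMap, Ideal.map_map, hcomp,
      ← Ideal.map_map, ← stalkIdeal_eq_map_stalkCongr_hom_of_eq hx' K]

/-- [OURS · L1 W4.2] **A canonical centre through the marked point is permissible there** (stages reached from a maximal origin, functional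
admissible oracle). [cite: CossartJannsenSaito2020, Def. 3.1, Thm. 5.17, Rem. 6.29 (1)] -/
theorem isPermissibleAt_of_isCanonicalStep_of_mem {p : ℕ} {R₀ : ∀ S : Scheme.{0}, CentreSeq S → Prop}
    (hRf : OracleFunctional R₀) (hRa : OracleAdmissible R₀) {ν : ℕ → ℕ} {X₀ : Scheme.{0}} [IsLocallyNoetherian X₀] {x : X₀}
    (hX : IsMaximalOrigin p 3 ν X₀ x) {s : MarkedStage.{0}} (hs : Reaches R₀ 3 ν (MarkedStage.init X₀ x) s)
    (C : s.W.IdealSheafData) (P' : Option (Pending (blowup C))) (hln' : IsLocallyNoetherian (blowup C)) (x' : ↥(blowup C))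
    (hcs : IsCanonicalStep R₀ 3 ν s.L s.P C P') (hx' : (blowup.π C).base x' = s.pt) (hcl : IsClosed ({x'} : Set ↥(blowup C)))
    (hstr : x' ∈ Scheme.hsStratum (blowup C) 3 ν) (hmem : s.pt ∈ (C.support : Set s.W)) :
    IdealSheafData.IsPermissibleAt C s.pt := by
  have hb : s.IsBlownUp R₀ 3 ν := MarkedStage.isBlownUp_of_mem hcs hmem
  have hstep : CanonicalNearStep R₀ 3 ν s ⟨blowup C, hln', s.L.next (Scheme.hsStratum s.W 3 ν) C, P', x'⟩ :=
    ⟨C, P', hln', x', hcs, hx', hcl, hstr, rfl⟩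
  have hν : ν ≠ iterPSum 3 Phi := fun hν => hX.not_isBlownUp_of_eq_iterPSum hRf hRa hν hs hstep hb
  obtain ⟨-, -, hperm, -⟩ := hX.centre_package hRa hν hs hcs
  exact hperm s.pt hmem

set_option maxHeartbeats 400000 in
/-- [OURS · L1 W4.2] **E-adapted CP frames along the boundary-threaded canonical chain, the face-reading binder asked only at steps THROUGH the
marked point.** See the module docstring. [cite: CossartPiltant2019, Def. 2.6–2.7 and Prop. 2.7 (arXiv v1 p. 14)] [cite: CossartJannsenSaito2020, Rem. 6.29 (1)] -/
theorem exists_isCPFrame_adapted_of_reachesσE_through {p : ℕ} {R₀ : ∀ S : Scheme.{0}, CentreSeq S → Prop}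
    (hRf : OracleFunctional R₀) (hRa : OracleAdmissible R₀) {ν : ℕ → ℕ} {X₀ : Scheme.{0}} [IsLocallyNoetherian X₀] {x : X₀}
    (hX : IsMaximalOrigin p 3 ν X₀ x) (E₀ : Boundary X₀)
    (hread : ∀ s : MarkedStageE.{0}, ReachesσE (Strategy.cjs R₀).withBoundary 3 ν (MarkedStageE.init X₀ x E₀) s →
      ∀ (C : s.W.IdealSheafData) (P' : Option (Pending (blowup C))), IsCanonicalStep R₀ 3 ν s.L s.P C P' →
      s.pt ∈ (C.support : Set s.W) →
      ∀ (R : Type) (_ : CommRing R) (_ : IsLocalRing R) (u : Fin 3 → R) (h : R[X])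
        (φ : (s.W.presheaf.stalk s.pt : Type) →+* R[X] ⧸ Ideal.span {h}) (e : s.W.IdealSheafData → Fin 3),
        IsCPFrame s.toMarkedStage R u h φ → IsAdicComplete (maximalIdeal R) R →
        (∀ i < h.natDegree, h.coeff i ∈ maximalIdeal R ^ (h.natDegree - i)) →
        (∀ I ∈ membersThrough s.E s.pt, (stalkIdeal I s.pt).map φ = Ideal.span {Ideal.Quotient.mk _ (Polynomial.C (u (e I)))}) →
        ∃ T : Finset (Fin 3),
          (stalkIdeal C s.pt).map φ =
            ((Ideal.span (u '' ↑T)).map (Polynomial.C : R →+* R[X]) ⊔ Ideal.span {X}).map (Ideal.Quotient.mk (Ideal.span {h})) ∧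
          ∀ i ∈ Finset.Icc 1 h.natDegree, h.coeff (h.natDegree - i) ∈ Ideal.span (u '' ↑T) ^ i)
    (h0 : ∃ (R : Type) (_ : CommRing R) (_ : IsLocalRing R) (u : Fin 3 → R) (h : R[X])
      (φ : ((MarkedStageE.init X₀ x E₀).W.presheaf.stalk (MarkedStageE.init X₀ x E₀).pt : Type) →+* R[X] ⧸ Ideal.span {h})
      (e : (MarkedStageE.init X₀ x E₀).W.IdealSheafData → Fin 3),
      IsCPFrame (MarkedStageE.init X₀ x E₀).toMarkedStage R u h φ ∧ IsAdicComplete (maximalIdeal R) R ∧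
      (∀ i < h.natDegree, h.coeff i ∈ maximalIdeal R ^ (h.natDegree - i)) ∧
      ∀ I ∈ membersThrough (MarkedStageE.init X₀ x E₀).E (MarkedStageE.init X₀ x E₀).pt,
        (stalkIdeal I (MarkedStageE.init X₀ x E₀).pt).map φ = Ideal.span {Ideal.Quotient.mk _ (Polynomial.C (u (e I)))})
    {s : MarkedStageE.{0}} (hs : ReachesσE (Strategy.cjs R₀).withBoundary 3 ν (MarkedStageE.init X₀ x E₀) s) :
    ∃ (R : Type) (_ : CommRing R) (_ : IsLocalRing R) (u : Fin 3 → R) (h : R[X])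
      (φ : (s.W.presheaf.stalk s.pt : Type) →+* R[X] ⧸ Ideal.span {h}) (e : s.W.IdealSheafData → Fin 3),
      IsCPFrame s.toMarkedStage R u h φ ∧ IsAdicComplete (maximalIdeal R) R ∧
      (∀ i < h.natDegree, h.coeff i ∈ maximalIdeal R ^ (h.natDegree - i)) ∧
      ∀ I ∈ membersThrough s.E s.pt, (stalkIdeal I s.pt).map φ = Ideal.span {Ideal.Quotient.mk _ (Polynomial.C (u (e I)))} := by
  classical
  induction hs with
  | refl => exact h0
  | tail hs' hstep ih =>
    rename_i s₁ s₂
    obtain ⟨R, _, _, u, h, φ, e, hF, hcpl, hco, hE⟩ := ih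
    have hstep' := hstep
    obtain ⟨C, P', hln', x', hσ, hx', hcl, hstr, rfl⟩ := hstep'
    have hcs : IsCanonicalStep R₀ 3 ν s₁.L s₁.P C P' := by
      rw [Strategy.withBoundary_step_iff, Strategy.cjs_step] at hσ
      exact hσ
    haveI : IsLocallyNoetherian s₁.W := s₁.ln
    haveI : IsLocallyNoetherian (blowup C) := hln'
    by_cases hmemC : s₁.pt ∈ (C.support : Set s₁.W)
    · -- GENUINE step: the E-adapted propagation (p-PropagationAdapted) in the face read by `hread`
      obtain ⟨T, hJ, hcoT⟩ := hread _ hs' C P' hcs hmemC R inferInstance inferInstance u h φ e hF hcpl hco hE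
      obtain ⟨R', _, _, u', h', φ', j₀, hF', hcpl', -, hco', -, hexc, hmem⟩ :=
        hF.exists_isCPFrame_blowup_adapted hRf hRa hX (reaches_of_reachesσE_cjs hs') C P' hln' x' hcs hx' hcl hstr T hJ hcoT
      -- the new reading: transforms keep their index, the exceptional member reads `j₀`
      let e' : (blowup C).IdealSheafData → Fin 3 := fun J =>
        if J = C.comap (blowup.π C) then j₀
        else if hJ : ∃ I, I ∈ membersThrough s₁.E s₁.pt ∧ Boundary.memberTransform C I = J then e hJ.choose else 0
      refine ⟨R', inferInstance, inferInstance, u', h', φ', e', hF', hcpl', hco', fun J hJm => ?_⟩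
      obtain ⟨hJE, hxJ⟩ := mem_membersThrough_iff.mp hJm
      by_cases hJexc : J = C.comap (blowup.π C)
      · have he' : e' J = j₀ := by simp only [e', hJexc, if_true]
        rw [he', hJexc]
        exact hexc
      · rcases (Boundary.mem_next_iff s₁.E C J).mp hJE with ⟨I, hIE, hIJ⟩ | hJ'
        swap
        · exact absurd hJ' hJexc
        have hxI : s₁.pt ∈ (I.support : Set s₁.W) := by
          have := Boundary.support_memberTransform_subset C I (hIJ ▸ hxJ)
          rw [Set.mem_preimage, hx'] at this
          exact this
        have hex : ∃ I, I ∈ membersThrough s₁.E s₁.pt ∧ Boundary.memberTransform C I = J :=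
          ⟨I, mem_membersThrough_iff.mpr ⟨hIE, hxI⟩, hIJ⟩
        have he' : e' J = e hex.choose := by simp only [e', hJexc, if_false, dif_pos hex]
        obtain ⟨hI₁m, hI₁J⟩ := hex.choose_spec
        rcases hmem hex.choose (e hex.choose) (hE _ hI₁m) with htop | ⟨-, hread'⟩
        · exfalso
          have hne := (mem_support_iff_stalkIdeal_ne_top J x').mp hxJ
          rw [← hI₁J] at hne
          exact hne htop
        · rw [he']
          show (stalkIdeal J x').map φ' = _
          have hJ' : stalkIdeal J x' = stalkIdeal (Boundary.memberTransform C hex.choose) x' := by rw [hI₁J]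
          rw [hJ']
          exact hread'
    · -- WAITING step: the frame passes unchanged, transforms keep their reading, the exceptional member misses `x'`
      obtain ⟨φ', hF', -, htop, hK⟩ := hF.exists_isCPFrame_blowup_waiting ν C P' hln' x' hx' hmemC
      let e' : (blowup C).IdealSheafData → Fin 3 := fun J =>
        if hJ : ∃ I, I ∈ membersThrough s₁.E s₁.pt ∧ Boundary.memberTransform C I = J then e hJ.choose else 0
      refine ⟨R, inferInstance, inferInstance, u, h, φ', e', hF', hcpl, hco, fun J hJm => ?_⟩
      obtain ⟨hJE, hxJ⟩ := mem_membersThrough_iff.mp hJm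
      have hne := (mem_support_iff_stalkIdeal_ne_top J x').mp hxJ
      rcases (Boundary.mem_next_iff s₁.E C J).mp hJE with ⟨I, hIE, hIJ⟩ | hJ'
      swap
      · exfalso
        rw [hJ'] at hne
        exact hne htop
      have hxI : s₁.pt ∈ (I.support : Set s₁.W) := by
        have := Boundary.support_memberTransform_subset C I (hIJ ▸ hxJ)
        rw [Set.mem_preimage, hx'] at this
        exact this
      have hex : ∃ I, I ∈ membersThrough s₁.E s₁.pt ∧ Boundary.memberTransform C I = J :=
        ⟨I, mem_membersThrough_iff.mpr ⟨hIE, hxI⟩, hIJ⟩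
      have he' : e' J = e hex.choose := by simp only [e', dif_pos hex]
      obtain ⟨hI₁m, hI₁J⟩ := hex.choose_spec
      rw [he']
      show (stalkIdeal J x').map φ' = _
      have hJ'' : stalkIdeal J x' = stalkIdeal (Boundary.memberTransform C hex.choose) x' := by rw [hI₁J]
      rw [hJ'']
      exact (hK hex.choose).trans (hE _ hI₁m)

end Summit.ResolutionOfSingularities.ResolutionOfSingularities.Theorems.SigmaMaxModificationsCorridor3.Moving

end
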